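import Summits.Ventures.PercRepro0.ZhangSkel
import Summits.Ventures.PercRepro0.ZhangSeparation
import Summits.Ventures.PercRepro0.TrifCreate

/-!
# P1 · HARRIS holds: `θ_2(½) = 0`, kernel-checked with no hypothesis

Cell pub-perc-repro0, seat p2 (gen 2).  The probabilistic skeleton `Zhang.P1_Harris_of` (ZhangSkel, p2)
applied to the two inputs that have since landed: the combinatorial separation
`ZhangSeparation.zhangSeparation_holds` (P9 Lemma 4.1, p1) and uniqueness `TrifCreate.P3_Unique_all`
(P3 · UNIQUE, Burton–Keane, p6).  This is the Lean twin of proofs/P1-harris-p1-v1.md Theorem P1, the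
`hP1` input of the certificates; nothing is claimed beyond the declared PARTIAL PROOF.
-/

namespace Summit.Ventures.PercRepro0.Zhang

open Summit.Ventures.PercRepro0.Defs

/-- **P1 · HARRIS holds**: `θ_2(½) = 0` (Zhang's argument, every step kernel-checked). -/
theorem P1_Harris_holds : P1_Harris :=
  P1_Harris_of Summit.Ventures.PercRepro0.ZhangSeparation.zhangSeparation_holds
    (Summit.Ventures.PercRepro0.TrifCreate.P3_Unique_all 2)

/-- `θ_2(½) = 0` in the `thetaI` form. -/
theorem thetaI_two_half : thetaI 2 (clamp (1 / 2)) = 0 := P1_Harris_holds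

end Summit.Ventures.PercRepro0.Zhang
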